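import Literature.MathematicalPhysics.QuantumManyBody.LiebYngvasonLowerBound
import Mathlib.Analysis.Real.Pi.Bounds
import HarnessLib

/-!
# The Lieb–Yngvason lower bound: assembly of LSSY Theorem 2.4 from the layers of its proof

Topic `Literature/MathematicalPhysics/QuantumManyBody`, companion of `LiebYngvasonLowerBound.lean`
(provefact `Literature.MathematicalPhysics.QuantumManyBody.BoseGas.LSSY2005_lowerBound_dirichlet`). That file records the three layers of
the printed proof of [LSSY2005, Thm. 2.4] as named facts — the Temple-inequality bound in a small
Neumann box `LSSY2005_boxLowerBound` (2.54)–(2.56), the cell method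
`LSSY2005_cellDecomposition` (2.52) and superadditivity `LSSY2005_superadditivity` (2.53). This
file carries out the remaining part of the printed proof, the optimisation over occupation
numbers and the choice of parameters [LSSY2005, (2.55)–(2.64)], and proves

* `LSSY2005_lowerBound_neumann_of_parts : B → C → E → LSSY2005_lowerBound_neumann`
  (Theorem 2.4 as printed, Neumann boundary conditions), and hence
* `LSSY2005_lowerBound_dirichlet_of_parts`, `LSSY2005_lowerBound_periodic_of_parts` — the two
  forms vendored in `PeriodicBoseGas.lean`.

with the explicit constants `C = 64`, `C' = 1`, `δ = (a/(2R₀+a))^{17/5}` (`R₀ ≥ 0` the range of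
the potential; the printed theorem only asserts existence of `δ, C, C'`).

## The argument, as formalised

Write `y = Y^{1/17}`, `Y = 4πρa³/3`, `ρ = N/L³`. If `1 - Cy ≤ 0` the bound is trivial, so
`y < 1/64` throughout, which is all the smallness used. Cells: `ℓ₀ = a y⁻⁶ < L` by the hypothesis
`L/a > C'Y^{-6/17}`, `M = ⌊L/ℓ₀⌋ ≥ 1`, `ℓ = L/M ∈ [ℓ₀, 2ℓ₀]` (`exists_cell_number`), so
`k := ρℓ³ = N/M³ ∈ [(3/16)y⁻¹, 2y⁻¹]` (`lyK_particle_number_bounds`, using `3 < π < 4`).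
Parameters (2.59)–(2.63): `ε = y`, `R = ℓy`, `p = ⌊4k⌋`; then the Temple denominator is
`≥ 2y/ℓ²`, the Temple error is `≤ 8y`, `R₀ ≤ R/2` (from `Y < δ`), and
`K(p,ℓ)(1 - 1/k) ≥ (1-y)(1-6y)(1-y)(1-8y)(1-16y/3) ≥ 1 - 64y` (`lyK_parameters`).
Step (2.55): `K(n) ≥ K(p) ≥ 0` for `n ≤ p` (`lyK_anti`), so with `c = (4πa/ℓ³)K(p)` the box
bound gives `E₀(n,ℓ) ≥ c n(n-1)` for `n ≤ p`, and superadditivity gives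
`E₀(n,ℓ) ≥ ⌊n/p⌋ E₀(p,ℓ)` for `n > p`. Steps (2.56)–(2.58): instead of minimising (2.57) over the
`c_n` we use its tangent line at `n = k`: `E₀(n,ℓ) + ck² ≥ c(2k-1)n` for all `n` as soon as
`p ≥ 4k - 1` (`affine_lowerBound_of_box_of_superadditive`); summing over the `M³` cells of any
occupation (`cell_lowerBound_of_affine`, from (2.52)) gives
`E₀(N,L) ≥ c(2k-1)N - M³ck² = cN(k-1) = 4πρaN·K(p)(1 - 1/(ρℓ³))`, which is (2.58), and (2.64)
follows (`lyK_final_algebra`).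

## References

* [LSSY2005] E. H. Lieb, R. Seiringer, J. P. Solovej, J. Yngvason, *The Mathematics of the Bose
  Gas and its Condensation*, Oberwolfach Seminars 34, Birkhäuser 2005 (arXiv:cond-mat/0610117):
  Thm. 2.4 (2.35); (2.52)–(2.64) pp. 16–17.
* [LiebYngvason1998] E. H. Lieb, J. Yngvason, *Ground state energy of the low density Bose gas*,
  Phys. Rev. Lett. 80 (1998) 2504–2507, eqs. (20)–(29).
-/

noncomputable section

open MeasureTheory Filter Metric
open scoped ENNReal NNReal

namespace Literature.MathematicalPhysics.QuantumManyBody.BoseGas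

/-! ### Step 1: superadditivity and the box bound give an affine lower bound ((2.53)–(2.57)) -/

/-- **Linearised form of (2.55)–(2.57).** Let `E : ℕ → [0,∞]` (the cell energies `E₀(n,ℓ)`)
satisfy `E(n) ≥ c n(n-1)` for `n ≤ p` (the box bound (2.54) with `K(n) ≥ K(p) =: c/(4πa/ℓ³)`,
(2.55)) and `E(qp + r) ≥ q E(p)` (superadditivity (2.53)). If `p ≥ 4k - 1` then
`E(n) + c k² ≥ c (2k-1) n` for *all* `n`: for `n ≤ p` because `n(n-1) - (2k-1)n + k² = (n-k)² ≥ 0`,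
and for `n > p` because `⌊n/p⌋ ≥ n/(2p)` and `p - 1 ≥ 2(2k-1)`, exactly as in the text after
(2.57) ("if `p ≥ 4k` the latter quantity is `≥ 2k`"). This affine minorant is the tangent at
`n = k` of the convex function minimised in (2.57), so it loses nothing.
[cite: LSSY2005, (2.53)–(2.57)] -/
theorem affine_lowerBound_of_box_of_superadditive {E : ℕ → ℝ≥0∞} {c k : ℝ} {p : ℕ}
    (hc : 0 ≤ c) (hp : 4 * k - 1 ≤ p) (hp1 : 1 ≤ p)
    (hbox : ∀ n : ℕ, n ≤ p → ENNReal.ofReal (c * n * (n - 1)) ≤ E n)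
    (hsup : ∀ q r : ℕ, (q : ℝ≥0∞) * E p ≤ E (q * p + r)) (n : ℕ) :
    ENNReal.ofReal (c * (2 * k - 1) * n) ≤ E n + ENNReal.ofReal (c * k ^ 2) := by
  rcases le_or_gt n p with hn | hn
  · -- `n ≤ p`: complete the square
    have hsq : c * (2 * k - 1) * n ≤ c * n * (n - 1) + c * k ^ 2 := by
      have : c * n * (n - 1) + c * k ^ 2 - c * (2 * k - 1) * n = c * (n - k) ^ 2 := by ring
      nlinarith [mul_nonneg hc (sq_nonneg ((n : ℝ) - k))]
    calc ENNReal.ofReal (c * (2 * k - 1) * n)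
        ≤ ENNReal.ofReal (c * n * (n - 1) + c * k ^ 2) := ENNReal.ofReal_le_ofReal hsq
      _ ≤ ENNReal.ofReal (c * n * (n - 1)) + ENNReal.ofReal (c * k ^ 2) := ENNReal.ofReal_add_le
      _ ≤ E n + ENNReal.ofReal (c * k ^ 2) := by gcongr; exact hbox n hn
  · -- `p < n`: `n = qp + r`, `q ≥ 1`, `r < p`, so `2qp > n`
    have hp0 : 0 < p := hp1
    set q := n / p with hq
    set r := n % p with hr
    have hnqr : q * p + r = n := Nat.div_add_mod' n p
    have hrp : r < p := Nat.mod_lt n hp0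
    have hq1 : 1 ≤ q := (Nat.one_le_div_iff hp0).2 hn.le
    have h2q : (n : ℝ) ≤ 2 * (q * p) := by
      have h1 : n < q * p + p := by omega
      have h2 : q * p + p ≤ 2 * (q * p) := by nlinarith
      exact_mod_cast (h1.trans_le h2).le
    have hpp : (0 : ℝ) ≤ (p : ℝ) - 1 := by
      have : (1 : ℝ) ≤ p := by exact_mod_cast hp1
      linarith
    have hkey : c * (2 * k - 1) * n ≤ q * (c * p * (p - 1)) := by
      have hk' : 2 * k - 1 ≤ ((p : ℝ) - 1) / 2 := by linarith
      calc c * (2 * k - 1) * n ≤ c * (((p : ℝ) - 1) / 2) * n := by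
            have hcn : 0 ≤ c * n := mul_nonneg hc (Nat.cast_nonneg n)
            nlinarith
        _ ≤ c * (((p : ℝ) - 1) / 2) * (2 * (q * p)) := by
            have : 0 ≤ c * (((p : ℝ) - 1) / 2) := by positivity
            exact mul_le_mul_of_nonneg_left h2q this
        _ = q * (c * p * (p - 1)) := by ring
    calc ENNReal.ofReal (c * (2 * k - 1) * n)
        ≤ ENNReal.ofReal (q * (c * p * (p - 1))) := ENNReal.ofReal_le_ofReal hkey
      _ = (q : ℝ≥0∞) * ENNReal.ofReal (c * p * (p - 1)) := by
          rw [ENNReal.ofReal_mul (Nat.cast_nonneg _), ENNReal.ofReal_natCast]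
      _ ≤ (q : ℝ≥0∞) * E p := by gcongr; exact hbox p le_rfl
      _ ≤ E (q * p + r) := hsup q r
      _ = E n := by rw [hnqr]
      _ ≤ E n + ENNReal.ofReal (c * k ^ 2) := le_self_add

/-! ### Step 2: the cell method turns the affine bound into a bound for the big box ((2.52), (2.58)) -/

/-- **(2.52) applied to an affine minorant.** If every cell energy satisfies
`E(n) + β ≥ α n` (`α ≥ 0`) and the big-box energy dominates `inf ∑_c E(n_c)` over all
occupations `(n_c)_c` of the `#ι` cells with `∑_c n_c = N` (the cell method (2.52)), then the
big-box energy plus `#ι · β` is at least `α N`. [cite: LSSY2005, (2.52) and (2.58)] -/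
theorem cell_lowerBound_of_affine {ι : Type*} [Fintype ι] {E : ℕ → ℝ≥0∞} {α : ℝ} {β Etot : ℝ≥0∞}
    (hα : 0 ≤ α) (haff : ∀ n : ℕ, ENNReal.ofReal (α * n) ≤ E n + β) {N : ℕ}
    (hcell : ⨅ (m : ι → ℕ) (_ : ∑ c, m c = N), ∑ c, E (m c) ≤ Etot) :
    ENNReal.ofReal (α * N) ≤ Etot + Fintype.card ι * β := by
  have key : ∀ m : ι → ℕ, ∑ c, m c = N →
      ENNReal.ofReal (α * N) ≤ ∑ c, E (m c) + Fintype.card ι * β := by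
    intro m hm
    calc ENNReal.ofReal (α * N) = ENNReal.ofReal (∑ c, α * m c) := by
          rw [← Finset.mul_sum, ← hm, Nat.cast_sum]
      _ = ∑ c, ENNReal.ofReal (α * m c) :=
          ENNReal.ofReal_sum_of_nonneg fun c _ => mul_nonneg hα (Nat.cast_nonneg _)
      _ ≤ ∑ c, (E (m c) + β) := Finset.sum_le_sum fun c _ => haff (m c)
      _ = ∑ c, E (m c) + Fintype.card ι * β := by
          rw [Finset.sum_add_distrib, Finset.sum_const, Finset.card_univ, nsmul_eq_mul]
  have hsub : ENNReal.ofReal (α * N) - Fintype.card ι * β ≤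
      ⨅ (m : ι → ℕ) (_ : ∑ c, m c = N), ∑ c, E (m c) :=
    le_iInf₂ fun m hm => tsub_le_iff_right.mpr (key m hm)
  calc ENNReal.ofReal (α * N)
      ≤ ENNReal.ofReal (α * N) - Fintype.card ι * β + Fintype.card ι * β := le_tsub_add
    _ ≤ Etot + Fintype.card ι * β := by gcongr; exact hsub.trans hcell

/-! ### Step 3: `K(n, ℓ)` is monotone decreasing in `n` ((2.55)) -/

/-- The Temple denominator `πε/ℓ² - 4an(n-1)/ℓ³` of (2.56) decreases with `n`. [cite: LSSY2005, (2.55)–(2.56)] -/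
theorem temple_denominator_anti {a ε ℓ : ℝ} {n p : ℕ} (ha : 0 ≤ a) (hℓ : 0 < ℓ) (hnp : n ≤ p) :
    Real.pi * ε / ℓ ^ 2 - 4 * a * p * (p - 1) / ℓ ^ 3 ≤
      Real.pi * ε / ℓ ^ 2 - 4 * a * n * (n - 1) / ℓ ^ 3 := by
  have hnn : (n : ℝ) * (n - 1) ≤ p * (p - 1) := by
    rcases Nat.eq_zero_or_pos p with hp | hp
    · subst hp
      have : n = 0 := Nat.le_zero.mp hnp
      subst this; simp
    · have h1 : (n : ℝ) ≤ p := by exact_mod_cast hnp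
      have h2 : (1 : ℝ) ≤ p := by exact_mod_cast hp
      nlinarith [Nat.cast_nonneg (α := ℝ) n]
  have : 4 * a * n * (n - 1) / ℓ ^ 3 ≤ 4 * a * p * (p - 1) / ℓ ^ 3 := by
    apply div_le_div_of_nonneg_right _ (by positivity)
    nlinarith
  linarith

/-- **(2.55): `K` is decreasing in `n`.** For `n ≤ p`, as long as the Temple denominator at `p`
is positive and the Temple error at `p` is at most `1` (so that `K(p) ≥ 0`),
`0 ≤ K(p) ≤ K(n)` (`K = lyK a R₀ R ε ℓ ·`; also `ε ≤ 1`, `2R ≤ ℓ`, `R₀³ < R³`,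
`4πR³/3 ≤ ℓ³`, `a ≥ 0`). [cite: LSSY2005, (2.55)–(2.56)] -/
theorem lyK_anti {a R₀ R ε ℓ : ℝ} {n p : ℕ} (ha : 0 ≤ a) (hε : ε ≤ 1) (hℓ : 0 < ℓ)
    (h2R : 2 * R ≤ ℓ) (hR₀ : 0 ≤ R₀) (hR : R₀ < R) (hq : 4 * Real.pi * R ^ 3 / (3 * ℓ ^ 3) ≤ 1)
    (hD : 0 < Real.pi * ε / ℓ ^ 2 - 4 * a * p * (p - 1) / ℓ ^ 3)
    (hT : 3 * a * p / (Real.pi * (R ^ 3 - R₀ ^ 3) *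
      (Real.pi * ε / ℓ ^ 2 - 4 * a * p * (p - 1) / ℓ ^ 3)) ≤ 1)
    (hnp : n ≤ p) :
    0 ≤ lyK a R₀ R ε ℓ p ∧ lyK a R₀ R ε ℓ p ≤ lyK a R₀ R ε ℓ n := by
  unfold lyK
  set q := 4 * Real.pi * R ^ 3 / (3 * ℓ ^ 3) with hq_def
  set Dp := Real.pi * ε / ℓ ^ 2 - 4 * a * p * (p - 1) / ℓ ^ 3 with hDp
  set Dn := Real.pi * ε / ℓ ^ 2 - 4 * a * n * (n - 1) / ℓ ^ 3 with hDn
  have hR0 : 0 < R := hR₀.trans_lt hR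
  have hΔ : 0 < R ^ 3 - R₀ ^ 3 := sub_pos.2 (pow_lt_pow_left₀ hR hR₀ three_ne_zero)
  have hq0 : 0 ≤ q := by positivity
  have hDnp : Dp ≤ Dn := temple_denominator_anti ha hℓ hnp
  have hDn : 0 < Dn := hD.trans_le hDnp
  -- the four factors
  have hF12 : 0 ≤ (1 - ε) * (1 - 2 * R / ℓ) ^ 3 := by
    apply mul_nonneg (sub_nonneg.2 hε)
    apply pow_nonneg
    rw [sub_nonneg, div_le_one hℓ]
    exact h2R
  have hF3p : 0 ≤ (1 - q) ^ (p - 1) := pow_nonneg (sub_nonneg.2 hq) _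
  have hF3 : (1 - q) ^ (p - 1) ≤ (1 - q) ^ (n - 1) :=
    pow_le_pow_of_le_one (sub_nonneg.2 hq) (sub_le_self _ hq0) (Nat.sub_le_sub_right hnp 1)
  have hTn : 3 * a * n / (Real.pi * (R ^ 3 - R₀ ^ 3) * Dn) ≤
      3 * a * p / (Real.pi * (R ^ 3 - R₀ ^ 3) * Dp) := by
    apply div_le_div₀ (by positivity) _ (by positivity) _
    · have : (n : ℝ) ≤ p := by exact_mod_cast hnp
      nlinarith
    · exact mul_le_mul_of_nonneg_left hDnp (by positivity)
  have hF4p : 0 ≤ 1 - 3 * a * p / (Real.pi * (R ^ 3 - R₀ ^ 3) * Dp) := sub_nonneg.2 hT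
  have hF4 : 1 - 3 * a * p / (Real.pi * (R ^ 3 - R₀ ^ 3) * Dp) ≤
      1 - 3 * a * n / (Real.pi * (R ^ 3 - R₀ ^ 3) * Dn) := sub_le_sub_left hTn 1
  constructor
  · exact mul_nonneg (mul_nonneg hF12 hF3p) hF4p
  · exact mul_le_mul (mul_le_mul_of_nonneg_left hF3 hF12) hF4 hF4p
      (mul_nonneg hF12 (hF3p.trans hF3))

/-! ### Step 4: the choice of parameters ((2.59)–(2.64)) -/

/-- Bookkeeping for products of factors `≥ 1 - aᵢ`: if `0 ≤ P`, `1 - s ≤ P`, `1 - t ≤ F` with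
`s, t ≥ 0`, `t ≤ 1`, then `1 - (s + t) ≤ P F` (and `0 ≤ P F`). [folklore] -/
theorem one_sub_add_le_mul {P F s t : ℝ} (hP0 : 0 ≤ P) (hP : 1 - s ≤ P) (hF : 1 - t ≤ F)
    (hs : 0 ≤ s) (ht0 : 0 ≤ t) (ht1 : t ≤ 1) : 0 ≤ P * F ∧ 1 - (s + t) ≤ P * F := by
  have hF0 : 0 ≤ F := (sub_nonneg.2 ht1).trans hF
  refine ⟨mul_nonneg hP0 hF0, ?_⟩
  rcases le_or_gt (1 - s) 0 with h | h
  · nlinarith [mul_nonneg hP0 hF0]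
  · calc 1 - (s + t) ≤ (1 - s) * (1 - t) := by nlinarith
      _ ≤ P * F := mul_le_mul hP hF (sub_nonneg.2 ht1) hP0

/-- (2.59)–(2.63), Temple denominator: with `ε = y`, `a ≤ ℓy⁶`, `p y ≤ 8` and `256y³ ≤ 1`,
`πy/ℓ² - 4ap(p-1)/ℓ³ ≥ 2y/ℓ²`. [cite: LSSY2005, (2.56) and (2.63)] -/
theorem lyK_temple_denominator_bound {a ℓ y p : ℝ} (ha : 0 ≤ a) (hy : 0 < y)
    (hy3 : 256 * y ^ 3 ≤ 1) (hℓ : 0 < ℓ) (haℓ : a ≤ ℓ * y ^ 6) (hp0 : 0 ≤ p) (hp8 : p * y ≤ 8) :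
    2 * y / ℓ ^ 2 ≤ Real.pi * y / ℓ ^ 2 - 4 * a * p * (p - 1) / ℓ ^ 3 := by
  have hpi3 := Real.pi_gt_three
  -- `4ap(p-1) ≤ 4ap² = 4a(py)²/y² ≤ 256 a/y² ≤ 256 ℓ y⁴ ≤ y ℓ`
  have h1 : 4 * a * p * (p - 1) ≤ 4 * a * p ^ 2 := by
    have : 0 ≤ 4 * a * p := by positivity
    nlinarith
  have h2 : (p * y) ^ 2 ≤ 64 := by nlinarith [mul_nonneg hp0 hy.le]
  have h3 : 4 * a * p ^ 2 * y ^ 2 ≤ y * ℓ * y ^ 2 :=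
    calc 4 * a * p ^ 2 * y ^ 2 = 4 * a * (p * y) ^ 2 := by ring
      _ ≤ 4 * a * 64 := by gcongr
      _ ≤ 256 * (ℓ * y ^ 6) := by linarith
      _ = y * ℓ * y ^ 2 * (256 * y ^ 3) := by ring
      _ ≤ y * ℓ * y ^ 2 * 1 := by gcongr
      _ = y * ℓ * y ^ 2 := mul_one _
  have h4 : 4 * a * p ^ 2 ≤ y * ℓ := le_of_mul_le_mul_right h3 (by positivity)
  have h5 : 4 * a * p * (p - 1) / ℓ ^ 3 ≤ y / ℓ ^ 2 := by
    rw [div_le_div_iff₀ (by positivity) (by positivity)]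
    calc 4 * a * p * (p - 1) * ℓ ^ 2 ≤ y * ℓ * ℓ ^ 2 :=
          mul_le_mul_of_nonneg_right (h1.trans h4) (by positivity)
      _ = y * ℓ ^ 3 := by ring
  have h6 : 3 * y / ℓ ^ 2 ≤ Real.pi * y / ℓ ^ 2 := by gcongr
  have h7 : 2 * y / ℓ ^ 2 = 3 * y / ℓ ^ 2 - y / ℓ ^ 2 := by ring
  linarith

/-- (2.59)–(2.63), the shell: with `R = ℓy`, `2R₀y⁵ ≤ a ≤ ℓy⁶` one has `R₀ ≤ R/2`, hence
`R³ - R₀³ ≥ R³/2`. [cite: LSSY2005, (2.44) and (2.63)] -/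
theorem lyK_shell_bound {a ℓ y R₀ : ℝ} (hy : 0 < y) (hℓ : 0 < ℓ) (haℓ : a ≤ ℓ * y ^ 6)
    (hR₀ : 0 ≤ R₀) (hR₀a : 2 * R₀ * y ^ 5 ≤ a) :
    R₀ ≤ ℓ * y / 2 ∧ (ℓ * y) ^ 3 / 2 ≤ (ℓ * y) ^ 3 - R₀ ^ 3 := by
  have hR₀R : R₀ ≤ ℓ * y / 2 := by
    have h : 2 * R₀ * y ^ 5 ≤ ℓ * y ^ 6 := hR₀a.trans haℓ
    have h' : R₀ * y ^ 5 ≤ (ℓ * y / 2) * y ^ 5 := by linarith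
    exact le_of_mul_le_mul_right h' (by positivity)
  refine ⟨hR₀R, ?_⟩
  have h3 : R₀ ^ 3 ≤ (ℓ * y / 2) ^ 3 := pow_le_pow_left₀ hR₀ hR₀R 3
  have h8 : (ℓ * y / 2) ^ 3 = (ℓ * y) ^ 3 / 8 := by ring
  have h0 : 0 ≤ (ℓ * y) ^ 3 := by positivity
  linarith

/-- (2.59)–(2.63), Temple error: if the Temple denominator is `D ≥ 2y/ℓ²`, the shell volume
factor is `Δ = R³ - R₀³ ≥ (ℓy)³/2`, `a ≤ ℓy⁶` and `py ≤ 8`, then `3ap/(πΔD) ≤ 8y`.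
[cite: LSSY2005, (2.49)–(2.50) and (2.63)] -/
theorem lyK_temple_error_bound {a ℓ y p D Δ : ℝ} (ha : 0 ≤ a) (hy : 0 < y) (hℓ : 0 < ℓ)
    (haℓ : a ≤ ℓ * y ^ 6) (hp8 : p * y ≤ 8) (hD : 2 * y / ℓ ^ 2 ≤ D)
    (hΔ : (ℓ * y) ^ 3 / 2 ≤ Δ) : 3 * a * p / (Real.pi * Δ * D) ≤ 8 * y := by
  have hpi3 := Real.pi_gt_three
  have hD0 : 0 < D := lt_of_lt_of_le (by positivity) hD
  have hΔ0 : 0 < Δ := lt_of_lt_of_le (by positivity) hΔ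
  have hden : 3 * ℓ * y ^ 4 ≤ Real.pi * Δ * D :=
    calc 3 * ℓ * y ^ 4 = 3 * ((ℓ * y) ^ 3 / 2) * (2 * y / ℓ ^ 2) := by field_simp
      _ ≤ Real.pi * Δ * D := by gcongr
  rw [div_le_iff₀ (by positivity)]
  have h1 : 3 * a * p * y ≤ 8 * y * (3 * ℓ * y ^ 4) * y :=
    calc 3 * a * p * y = 3 * a * (p * y) := by ring
      _ ≤ 3 * a * 8 := by gcongr
      _ ≤ 24 * (ℓ * y ^ 6) := by linarith
      _ = 8 * y * (3 * ℓ * y ^ 4) * y := by ring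
  have h2 : 3 * a * p ≤ 8 * y * (3 * ℓ * y ^ 4) := le_of_mul_le_mul_right h1 hy
  exact h2.trans (mul_le_mul_of_nonneg_left hden (by positivity))

/-- (2.59)–(2.63), nearest-neighbour factor: `(1 - 4πy³/3)^{p-1} ≥ 1 - p·(16/3)y³ ≥ 1 - y`
for `py ≤ 8`, `y ≤ 1/64` (Bernoulli). [cite: LSSY2005, (2.44) and (2.63)] -/
theorem lyK_shell_probability_bound {y : ℝ} {p : ℕ} (hy : 0 < y) (hy1 : y ≤ 1 / 64)
    (hp8 : (p : ℝ) * y ≤ 8) : 1 - y ≤ (1 - 4 * Real.pi / 3 * y ^ 3) ^ (p - 1) := by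
  have hpi4 := Real.pi_lt_four
  have hy3 : y ^ 3 ≤ 1 / 8 := by
    have := pow_le_pow_left₀ hy.le (hy1.trans (by norm_num : (1 : ℝ) / 64 ≤ 1 / 2)) 3
    norm_num at this
    exact this
  have hq2 : -2 ≤ -(4 * Real.pi / 3 * y ^ 3) := by
    have : 4 * Real.pi / 3 * y ^ 3 ≤ 4 * 4 / 3 * (1 / 8) :=
      mul_le_mul (by linarith) hy3 (by positivity) (by positivity)
    linarith
  have hB : 1 + ((p - 1 : ℕ) : ℝ) * -(4 * Real.pi / 3 * y ^ 3) ≤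
      (1 + -(4 * Real.pi / 3 * y ^ 3)) ^ (p - 1) := one_add_mul_le_pow hq2 (p - 1)
  have hp1 : ((p - 1 : ℕ) : ℝ) ≤ p := Nat.cast_le.mpr (Nat.sub_le p 1)
  have hq0 : 0 ≤ 4 * Real.pi / 3 * y ^ 3 := by positivity
  have h1 : (p : ℝ) * (4 * Real.pi / 3 * y ^ 3) ≤ y :=
    calc (p : ℝ) * (4 * Real.pi / 3 * y ^ 3) = (4 * Real.pi / 3) * (p * y) * y ^ 2 := by ring
      _ ≤ (16 / 3) * 8 * y ^ 2 := by gcongr; linarith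
      _ = y * (128 / 3 * y) := by ring
      _ ≤ y * 1 := by gcongr; linarith
      _ = y := mul_one y
  calc 1 - y ≤ 1 + ((p - 1 : ℕ) : ℝ) * -(4 * Real.pi / 3 * y ^ 3) := by
        nlinarith [mul_le_mul_of_nonneg_right hp1 hq0]
    _ ≤ (1 + -(4 * Real.pi / 3 * y ^ 3)) ^ (p - 1) := hB
    _ = (1 - 4 * Real.pi / 3 * y ^ 3) ^ (p - 1) := by ring

/-- **The parameter choice (2.59)–(2.64) of the proof of Theorem 2.4**, made explicit. Write
`y = Y^{1/17}` and take `ε = y`, `R = ℓ y`, a cell of side `ℓ ≥ a y⁻⁶` holding `k = ρℓ³`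
particles with `(3/16) y⁻¹ ≤ k ≤ 2 y⁻¹` (i.e. `ρa³ = 3Y/(4π)`, `a y⁻⁶ ≤ ℓ ≤ 2a y⁻⁶`, `3 < π < 4`),
`p ≤ 4k`, and a range `R₀` with `2R₀y⁵ ≤ a`. If `y ≤ 1/64` then the Temple denominator at `p`
is positive, the Temple error at `p` is at most `1`, `R₀ < R`, and
`K(p, ℓ) (1 - 1/(ρℓ³)) ≥ 1 - 64 y` — the five error factors of (2.64)
(`ε`, `(a/ℓ)³/(…)`, `R/ℓ`, `ρR³`, `1/(ρℓ³)`) each being `1 - O(y)`.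
[cite: LSSY2005, (2.59)–(2.64)] -/
theorem lyK_parameters {a R₀ ℓ k y R ε : ℝ} {p : ℕ} (ha : 0 < a) (hy : 0 < y)
    (hy1 : y ≤ 1 / 64) (hℓ1 : a / y ^ 6 ≤ ℓ) (hk1 : 3 / 16 / y ≤ k) (hk2 : k ≤ 2 / y)
    (hp : (p : ℝ) ≤ 4 * k) (hR₀ : 0 ≤ R₀) (hR₀a : 2 * R₀ * y ^ 5 ≤ a) (hR : R = ℓ * y)
    (hε : ε = y) :
    0 < Real.pi * ε / ℓ ^ 2 - 4 * a * p * (p - 1) / ℓ ^ 3 ∧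
    3 * a * p / (Real.pi * (R ^ 3 - R₀ ^ 3) *
      (Real.pi * ε / ℓ ^ 2 - 4 * a * p * (p - 1) / ℓ ^ 3)) ≤ 1 ∧
    R₀ < R ∧
    1 - 64 * y ≤ lyK a R₀ R ε ℓ p * (1 - 1 / k) := by
  subst hR hε
  have hy6 : 0 < ε ^ 6 := by positivity
  have hℓ : 0 < ℓ := (div_pos ha hy6).trans_le hℓ1
  have haℓ : a ≤ ℓ * ε ^ 6 := by rwa [div_le_iff₀ hy6] at hℓ1
  have hε1 : ε ≤ 1 := hy1.trans (by norm_num)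
  have hy3 : 256 * ε ^ 3 ≤ 1 := by
    have : ε ^ 3 ≤ (1 / 64) ^ 3 := pow_le_pow_left₀ hy.le hy1 3
    norm_num at this
    linarith
  have hk0 : 0 < k := lt_of_lt_of_le (by positivity) hk1
  have hp0 : (0 : ℝ) ≤ p := Nat.cast_nonneg p
  have hp8 : (p : ℝ) * ε ≤ 8 := by
    have h8 : 4 * k ≤ 8 / ε := by rw [show (8 : ℝ) / ε = 4 * (2 / ε) by ring]; linarith
    have : (p : ℝ) ≤ 8 / ε := hp.trans h8
    rwa [le_div_iff₀ hy] at this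
  have hD2 := lyK_temple_denominator_bound ha.le hy hy3 hℓ haℓ hp0 hp8
  obtain ⟨hR₀R, hΔ⟩ := lyK_shell_bound hy hℓ haℓ hR₀ hR₀a
  have hT8 := lyK_temple_error_bound ha.le hy hℓ haℓ hp8 hD2 hΔ
  have hD : 0 < Real.pi * ε / ℓ ^ 2 - 4 * a * p * (p - 1) / ℓ ^ 3 :=
    lt_of_lt_of_le (by positivity) hD2
  have hR₀ltR : R₀ < ℓ * ε := hR₀R.trans_lt (by linarith [mul_pos hℓ hy])
  refine ⟨hD, hT8.trans (by linarith), hR₀ltR, ?_⟩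
  -- the five factors
  have hq : 4 * Real.pi * (ℓ * ε) ^ 3 / (3 * ℓ ^ 3) = 4 * Real.pi / 3 * ε ^ 3 := by
    field_simp
  have h2R : 2 * (ℓ * ε) / ℓ = 2 * ε := by field_simp
  have hF2 : 1 - 6 * ε ≤ (1 - 2 * (ℓ * ε) / ℓ) ^ 3 := by
    rw [h2R]
    have : (1 - 2 * ε) ^ 3 = 1 - 6 * ε + ε ^ 2 * (12 - 8 * ε) := by ring
    rw [this]
    have : 0 ≤ ε ^ 2 * (12 - 8 * ε) := mul_nonneg (sq_nonneg ε) (by linarith)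
    linarith
  have hF3 : 1 - ε ≤ (1 - 4 * Real.pi * (ℓ * ε) ^ 3 / (3 * ℓ ^ 3)) ^ (p - 1) := by
    rw [hq]; exact lyK_shell_probability_bound hy hy1 hp8
  have hF4 : 1 - 8 * ε ≤ 1 - 3 * a * p / (Real.pi * ((ℓ * ε) ^ 3 - R₀ ^ 3) *
      (Real.pi * ε / ℓ ^ 2 - 4 * a * p * (p - 1) / ℓ ^ 3)) := by linarith
  have hF5 : 1 - 16 / 3 * ε ≤ 1 - 1 / k := by
    have : 1 / k ≤ 16 / 3 * ε := by
      rw [div_le_iff₀ hk0]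
      calc (1 : ℝ) = 16 / 3 * ε * (3 / 16 / ε) := by field_simp
        _ ≤ 16 / 3 * ε * k := by gcongr
    linarith
  unfold lyK
  obtain ⟨h12₀, h12⟩ := one_sub_add_le_mul (sub_nonneg.2 hε1) le_rfl hF2 hy.le (by positivity)
    (by linarith)
  obtain ⟨h123₀, h123⟩ := one_sub_add_le_mul h12₀ h12 hF3 (by positivity) hy.le hε1
  obtain ⟨h1234₀, h1234⟩ := one_sub_add_le_mul h123₀ h123 hF4 (by positivity) (by positivity)
    (by linarith)
  obtain ⟨-, h12345⟩ := one_sub_add_le_mul h1234₀ h1234 hF5 (by positivity) (by positivity)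
    (by linarith)
  linarith

/-! ### Theorem 2.4 from its three layers -/

/-- Exponent bookkeeping for `y = Y^{1/17}`: `y¹⁷ = Y`, `Y^{-6/17} = y⁻⁶`, `Y^{5/17} = y⁵`. [folklore] -/
theorem rpow_seventeenth {Y : ℝ} (hY : 0 ≤ Y) :
    (Y ^ ((1 : ℝ) / 17)) ^ 17 = Y ∧ Y ^ (-(6 : ℝ) / 17) = ((Y ^ ((1 : ℝ) / 17)) ^ 6)⁻¹ ∧
      Y ^ ((5 : ℝ) / 17) = (Y ^ ((1 : ℝ) / 17)) ^ 5 := by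
  refine ⟨?_, ?_, ?_⟩
  · rw [← Real.rpow_natCast, ← Real.rpow_mul hY]; norm_num
  · rw [← Real.rpow_natCast, ← Real.rpow_mul hY, ← Real.rpow_neg hY]; norm_num
  · rw [← Real.rpow_natCast, ← Real.rpow_mul hY]; norm_num

/-- The cells (2.52): a box of side `L > ℓ₀` is `M³` cells of side `ℓ = L/M ∈ [ℓ₀, 2ℓ₀]`,
`M = ⌊L/ℓ₀⌋ ≥ 1`. [cite: LSSY2005, (2.52) and (2.63)] -/
theorem exists_cell_number {L ℓ₀ : ℝ} (hℓ₀ : 0 < ℓ₀) (hL : ℓ₀ < L) :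
    ∃ M : ℕ, 0 < M ∧ (M : ℝ) * (L / M) = L ∧ ℓ₀ ≤ L / M ∧ L / M ≤ 2 * ℓ₀ := by
  have hM1 : 1 ≤ ⌊L / ℓ₀⌋₊ := (Nat.one_le_floor_iff _).2 (by rw [le_div_iff₀ hℓ₀]; linarith)
  have hMr : (0 : ℝ) < ⌊L / ℓ₀⌋₊ := Nat.cast_pos.2 hM1
  have hMr1 : (1 : ℝ) ≤ ⌊L / ℓ₀⌋₊ := by exact_mod_cast hM1
  have hMle : (⌊L / ℓ₀⌋₊ : ℝ) ≤ L / ℓ₀ :=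
    Nat.floor_le (div_nonneg (hℓ₀.le.trans hL.le) hℓ₀.le)
  have hMlt : L / ℓ₀ < ⌊L / ℓ₀⌋₊ + 1 := Nat.lt_floor_add_one _
  rw [le_div_iff₀ hℓ₀] at hMle
  rw [div_lt_iff₀ hℓ₀] at hMlt
  refine ⟨⌊L / ℓ₀⌋₊, hM1, mul_div_cancel₀ L hMr.ne', ?_, ?_⟩
  · rw [le_div_iff₀ hMr]; linarith
  · rw [div_le_iff₀ hMr]; nlinarith

/-- Particles per cell (2.62)–(2.63): with `ρa³ = 3y¹⁷/(4π)` and `a y⁻⁶ ≤ ℓ ≤ 2a y⁻⁶`,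
`k = ρℓ³ ∈ [(3/16) y⁻¹, 2 y⁻¹]` (using `3 < π < 4`). [cite: LSSY2005, (2.62)–(2.63)] -/
theorem lyK_particle_number_bounds {ρ a y ℓ : ℝ} (hρ : 0 < ρ) (ha : 0 < a) (hy : 0 < y)
    (hρa : ρ * a ^ 3 = 3 / (4 * Real.pi) * y ^ 17) (hℓ1 : a / y ^ 6 ≤ ℓ)
    (hℓ2 : ℓ ≤ 2 * (a / y ^ 6)) : 3 / 16 / y ≤ ρ * ℓ ^ 3 ∧ ρ * ℓ ^ 3 ≤ 2 / y := by
  have hpi3 := Real.pi_gt_three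
  have hpi4 := Real.pi_lt_four
  have hℓ₀ : 0 < a / y ^ 6 := by positivity
  have hℓ : 0 ≤ ℓ := hℓ₀.le.trans hℓ1
  have hρℓ₀ : ρ * (a / y ^ 6) ^ 3 = 3 / (4 * Real.pi) / y := by
    rw [div_pow, mul_div_assoc', hρa, div_eq_div_iff (by positivity) hy.ne']
    ring
  constructor
  · calc 3 / 16 / y ≤ 3 / (4 * Real.pi) / y :=
          div_le_div_of_nonneg_right
            (div_le_div_of_nonneg_left (by norm_num) (by positivity) (by linarith)) hy.le
      _ = ρ * (a / y ^ 6) ^ 3 := hρℓ₀.symm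
      _ ≤ ρ * ℓ ^ 3 := by gcongr
  · calc ρ * ℓ ^ 3 ≤ ρ * (2 * (a / y ^ 6)) ^ 3 := by gcongr
      _ = 8 * (ρ * (a / y ^ 6) ^ 3) := by ring
      _ = 6 / Real.pi / y := by
          rw [hρℓ₀]
          field_simp
          norm_num
      _ ≤ 2 / y := by
          apply div_le_div_of_nonneg_right _ hy.le
          rw [div_le_iff₀ Real.pi_pos]
          linarith

/-- The range condition: `Y < δ = (a/(2R₀+a))^{17/5}` gives `2R₀ y⁵ ≤ a` for `y = Y^{1/17}`
(so that `R₀ ≤ R/2` for the choice `R = ℓy`, `ℓ ≥ a y⁻⁶`). [cite: LSSY2005, Thm. 2.4 and (2.63)] -/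
theorem lyK_range_bound {Y a R₀ : ℝ} (hY0 : 0 ≤ Y) (ha : 0 < a) (hR₀ : 0 ≤ R₀)
    (hY : Y < (a / (2 * R₀ + a)) ^ ((17 : ℝ) / 5)) : 2 * R₀ * (Y ^ ((1 : ℝ) / 17)) ^ 5 ≤ a := by
  obtain ⟨-, -, hY5⟩ := rpow_seventeenth hY0
  have h1 : Y ^ ((5 : ℝ) / 17) < a / (2 * R₀ + a) := by
    have := Real.rpow_lt_rpow hY0 hY (by norm_num : (0 : ℝ) < 5 / 17)
    rwa [← Real.rpow_mul (by positivity), show (17 : ℝ) / 5 * (5 / 17) = 1 by norm_num,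
      Real.rpow_one] at this
  rw [hY5, lt_div_iff₀ (by positivity)] at h1
  nlinarith [mul_nonneg ha.le (pow_nonneg (Real.rpow_nonneg hY0 ((1 : ℝ) / 17)) 5)]

/-- The algebra of (2.58): with `c = (4πa/ℓ³) K(p)`, `k = ρℓ³ = N/M³`,
`c(2k-1)N - M³ c k² = c N (k-1) = 4πρaN · K(p) (1 - 1/(ρℓ³))`, so a bound
`K(p)(1 - 1/(ρℓ³)) ≥ 1 - Cy` gives `4πρa(1 - Cy)N ≤ c(2k-1)N - M³ck²`. [cite: LSSY2005, (2.58)] -/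
theorem lyK_final_algebra {ρ a ℓ k N M Kp C y : ℝ} (hρ : 0 < ρ) (ha : 0 ≤ a) (hℓ : 0 < ℓ)
    (hN : 0 ≤ N) (hkρ : k = ρ * ℓ ^ 3) (hkM : k * M ^ 3 = N)
    (hmain : 1 - C * y ≤ Kp * (1 - 1 / k)) :
    4 * Real.pi * ρ * a * (1 - C * y) * N ≤
      4 * Real.pi * a / ℓ ^ 3 * Kp * (2 * k - 1) * N - M ^ 3 * (4 * Real.pi * a / ℓ ^ 3 * Kp * k ^ 2) := by
  have hk0 : 0 < k := by rw [hkρ]; positivity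
  have h1 : 4 * Real.pi * a / ℓ ^ 3 * Kp * (2 * k - 1) * N -
      M ^ 3 * (4 * Real.pi * a / ℓ ^ 3 * Kp * k ^ 2) =
      4 * Real.pi * a / ℓ ^ 3 * Kp * N * (k - 1) := by
    rw [← hkM]; ring
  have h2 : 4 * Real.pi * a / ℓ ^ 3 * Kp * N * (k - 1) =
      4 * Real.pi * ρ * a * N * (Kp * (1 - 1 / k)) := by
    rw [hkρ, div_eq_mul_inv, one_div]
    field_simp
  rw [h1, h2]
  calc 4 * Real.pi * ρ * a * (1 - C * y) * N
      = 4 * Real.pi * ρ * a * N * (1 - C * y) := by ring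
    _ ≤ 4 * Real.pi * ρ * a * N * (Kp * (1 - 1 / k)) :=
        mul_le_mul_of_nonneg_left hmain (by positivity)

/-- **LSSY Theorem 2.4 (Neumann) from its layers**: the box bound (2.54) (`LSSY2005_boxLowerBound`),
the cell method (2.52) (`LSSY2005_cellDecomposition`) and superadditivity (2.53)
(`LSSY2005_superadditivity`) imply Theorem 2.4 as printed, with the explicit constants
`C = 64`, `C' = 1`, `δ = (a/(2R₀ + a))^{17/5}` (`R₀ ≥ 0` the range of `v`). The proof is the
printed one, (2.55)–(2.64): cells of side `ℓ ∈ [aY^{-6/17}, 2aY^{-6/17}]` with `L = Mℓ`,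
`ε = Y^{1/17}`, `R = ℓ Y^{1/17}`, `p = ⌊4ρℓ³⌋`, the minimisation (2.57) being replaced by its
tangent-line form (`affine_lowerBound_of_box_of_superadditive`). [cite: LSSY2005, Thm. 2.4 and (2.52)–(2.64)] -/
theorem LSSY2005_lowerBound_neumann_of_parts (hB : LSSY2005_boxLowerBound)
    (hC : LSSY2005_cellDecomposition) (hE : LSSY2005_superadditivity) :
    LSSY2005_lowerBound_neumann := by
  intro v hv hfin
  obtain ⟨hmeas, R₀', hR₀'⟩ := hv
  set R₀ := max R₀' 0 with hR₀_def
  have hR₀ : 0 ≤ R₀ := le_max_right _ _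
  have hvR₀ : ∀ r, R₀ < r → v r = 0 := fun r hr => hR₀' r ((le_max_left _ _).trans_lt hr)
  rcases (ENNReal.toReal_nonneg : 0 ≤ (scatteringLength v).toReal).eq_or_lt with ha | ha
  · -- `a = 0`: the hypothesis `L/a > C' Y^{-6/17}` reads `0 < 0`
    refine ⟨1, 1, 1, one_pos, one_pos, one_pos, ?_⟩
    intro N L hL a ρ Y hY hL'
    exfalso
    have haz : a = 0 := ha.symm
    have hYz : Y = 0 := by
      show 4 * Real.pi * ρ * a ^ 3 / 3 = 0
      rw [haz]; ring
    have h : (1 : ℝ) * Y ^ (-(6 : ℝ) / 17) < L / a := hL'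
    rw [hYz, haz, div_zero, Real.zero_rpow (by norm_num), mul_zero] at h
    exact lt_irrefl 0 h
  -- `a > 0`
  refine ⟨((scatteringLength v).toReal / (2 * R₀ + (scatteringLength v).toReal)) ^ ((17 : ℝ) / 5),
    64, 1, by positivity, by norm_num, one_pos, ?_⟩
  intro N L hL a ρ Y hY hL'
  change 0 < a at ha
  change Y < (a / (2 * R₀ + a)) ^ ((17 : ℝ) / 5) at hY
  change 1 * Y ^ (-(6 : ℝ) / 17) < L / a at hL'
  show ENNReal.ofReal (4 * Real.pi * ρ * a * (1 - 64 * Y ^ ((1 : ℝ) / 17)) * N) ≤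
    neumannGroundStateEnergy v N L
  have ha_def : a = (scatteringLength v).toReal := rfl
  have hρ_def : ρ = N / L ^ 3 := rfl
  have hY_def : Y = 4 * Real.pi * ρ * a ^ 3 / 3 := rfl
  clear_value Y ρ a
  -- `N = 0` is trivial
  rcases Nat.eq_zero_or_pos N with hN0 | hNpos
  · subst hN0; simp
  have hN : (0 : ℝ) < N := Nat.cast_pos.2 hNpos
  have hρ : 0 < ρ := by rw [hρ_def]; positivity
  have hY0 : 0 < Y := by rw [hY_def]; positivity
  -- exponent bookkeeping, `y = Y^{1/17}`; the range condition
  have hR₀a := lyK_range_bound hY0.le ha hR₀ hY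
  obtain ⟨hY17, hY6, -⟩ := rpow_seventeenth hY0.le
  set y := Y ^ ((1 : ℝ) / 17) with hy_def
  have hy : 0 < y := Real.rpow_pos_of_pos hY0 _
  -- if `1 - C y ≤ 0` the bound is trivial; otherwise `y < 1/64` is all the smallness needed
  rcases le_or_gt (1 - 64 * y) 0 with hsmall | hpos
  · have : 4 * Real.pi * ρ * a * (1 - 64 * y) * N ≤ 0 :=
      mul_nonpos_of_nonpos_of_nonneg
        (mul_nonpos_of_nonneg_of_nonpos (by positivity) hsmall) hN.le
    rw [ENNReal.ofReal_of_nonpos this]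
    exact bot_le
  have hy1 : y ≤ 1 / 64 := by linarith
  have hy_lt1 : y < 1 := by linarith
  have hρa : ρ * a ^ 3 = 3 / (4 * Real.pi) * y ^ 17 := by
    rw [hY17, hY_def]; field_simp
  -- the cells: `ℓ₀ = a y⁻⁶ < L`, `L = M ℓ`, `ℓ₀ ≤ ℓ ≤ 2ℓ₀`
  have hℓ₀ : 0 < a / y ^ 6 := by positivity
  have hLℓ₀ : a / y ^ 6 < L := by
    rw [one_mul, hY6, lt_div_iff₀ ha] at hL'
    rwa [div_eq_inv_mul]
  obtain ⟨M, hM0, hMℓ, hℓ1, hℓ2⟩ := exists_cell_number hℓ₀ hLℓ₀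
  set ℓ := L / M with hℓ_def
  have hMr : (0 : ℝ) < M := Nat.cast_pos.2 hM0
  have hℓ : 0 < ℓ := hℓ₀.trans_le hℓ1
  -- particles per cell `k = ρℓ³ = N/M³`, and `p = ⌊4k⌋`
  obtain ⟨hk1, hk2⟩ := lyK_particle_number_bounds hρ ha hy hρa hℓ1 hℓ2
  set k := ρ * ℓ ^ 3 with hkρ
  have hkM : k * (M : ℝ) ^ 3 = N := by
    rw [hkρ, hρ_def, ← hMℓ]; field_simp
  have hk12 : (12 : ℝ) ≤ k := by
    refine le_trans ?_ hk1
    rw [le_div_iff₀ hy]; linarith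
  set p := ⌊4 * k⌋₊ with hp_def
  have hp_le : (p : ℝ) ≤ 4 * k := Nat.floor_le (by positivity)
  have hp_ge : 4 * k - 1 ≤ p := by have := Nat.lt_floor_add_one (4 * k); linarith
  have hp1 : 1 ≤ p := by rw [hp_def, Nat.one_le_floor_iff]; linarith
  -- the parameters `ε = y`, `R = ℓy` and the estimate (2.64)
  obtain ⟨hD, hT, hR₀R, hmain⟩ :=
    lyK_parameters (R := ℓ * y) (ε := y) (p := p) ha hy hy1 hℓ1 hk1 hk2 hp_le hR₀ hR₀a rfl rfl
  have h2R : 2 * (ℓ * y) < ℓ := by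
    have : ℓ * (2 * y) < ℓ * 1 := mul_lt_mul_of_pos_left (by linarith) hℓ
    linarith
  have hq1 : 4 * Real.pi * (ℓ * y) ^ 3 / (3 * ℓ ^ 3) ≤ 1 := by
    have hy3 : y ^ 3 ≤ 1 / 8 := by
      have := pow_le_pow_left₀ hy.le (hy1.trans (by norm_num : (1 : ℝ) / 64 ≤ 1 / 2)) 3
      norm_num at this
      exact this
    rw [div_le_one (by positivity)]
    calc 4 * Real.pi * (ℓ * y) ^ 3 = 4 * Real.pi * y ^ 3 * ℓ ^ 3 := by ring
      _ ≤ 4 * 4 * (1 / 8) * ℓ ^ 3 := by gcongr; exact Real.pi_lt_four.le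
      _ ≤ 3 * ℓ ^ 3 := by linarith [pow_pos hℓ 3]
  set Kp := lyK a R₀ (ℓ * y) y ℓ p with hKp_def
  obtain ⟨hKp0, -⟩ := lyK_anti ha.le hy_lt1.le hℓ h2R.le hR₀ hR₀R hq1 hD hT le_rfl
  set c := 4 * Real.pi * a / ℓ ^ 3 * Kp with hc_def
  have hc0 : 0 ≤ c := mul_nonneg (by positivity) hKp0
  -- Step 1: the box bound (2.54)–(2.55) for `n ≤ p` and superadditivity (2.53)
  have hbox : ∀ n : ℕ, n ≤ p →
      ENNReal.ofReal (c * n * (n - 1)) ≤ neumannGroundStateEnergy v n ℓ := by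
    intro n hn
    obtain ⟨-, hKn⟩ := lyK_anti ha.le hy_lt1.le hℓ h2R.le hR₀ hR₀R hq1 hD hT hn
    have hDn := hD.trans_le (temple_denominator_anti (ε := y) ha.le hℓ hn)
    rw [ha_def] at hDn
    have hBn := hB v R₀ hmeas hR₀ hvR₀ hfin n ℓ y (ℓ * y) hy hy_lt1 hR₀R h2R hDn
    rw [← ha_def] at hBn
    refine le_trans (ENNReal.ofReal_le_ofReal ?_) hBn
    have hnn : (0 : ℝ) ≤ n * (n - 1) := by
      rcases Nat.eq_zero_or_pos n with h0 | h0
      · subst h0; simp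
      · have : (1 : ℝ) ≤ n := by exact_mod_cast h0
        exact mul_nonneg (by positivity) (by linarith)
    calc c * n * (n - 1) = 4 * Real.pi * a / ℓ ^ 3 * (n * (n - 1)) * Kp := by rw [hc_def]; ring
      _ ≤ 4 * Real.pi * a / ℓ ^ 3 * (n * (n - 1)) * lyK a R₀ (ℓ * y) y ℓ n :=
          mul_le_mul_of_nonneg_left hKn (mul_nonneg (by positivity) hnn)
      _ = 4 * Real.pi * a / ℓ ^ 3 * n * (n - 1) * lyK a R₀ (ℓ * y) y ℓ n := by ring
  have hsup : ∀ q r : ℕ, (q : ℝ≥0∞) * neumannGroundStateEnergy v p ℓ ≤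
      neumannGroundStateEnergy v (q * p + r) ℓ := fun q r => hE.mul_le hmeas hℓ p q r
  have haff := affine_lowerBound_of_box_of_superadditive
    (E := fun n => neumannGroundStateEnergy v n ℓ) hc0 hp_ge hp1 hbox hsup
  -- Step 2: the cell method (2.52)
  have hcell := hC v hmeas N M ℓ hM0 hℓ
  rw [hMℓ] at hcell
  have hα : 0 ≤ c * (2 * k - 1) := mul_nonneg hc0 (by linarith)
  have hbig := cell_lowerBound_of_affine (ι := Fin (M ^ 3))
    (E := fun n => neumannGroundStateEnergy v n ℓ) (β := ENNReal.ofReal (c * k ^ 2)) hα haff hcell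
  have hβ : (Fintype.card (Fin (M ^ 3)) : ℝ≥0∞) * ENNReal.ofReal (c * k ^ 2) =
      ENNReal.ofReal ((M : ℝ) ^ 3 * (c * k ^ 2)) := by
    rw [Fintype.card_fin, ← ENNReal.ofReal_natCast,
      ← ENNReal.ofReal_mul (p := ((M ^ 3 : ℕ) : ℝ)) (by positivity), Nat.cast_pow]
  rw [hβ] at hbig
  -- Step 4: (2.58) with (2.64)
  have hreal := lyK_final_algebra (M := (M : ℝ)) (C := 64) hρ ha.le hℓ hN.le rfl hkM hmain
  calc ENNReal.ofReal (4 * Real.pi * ρ * a * (1 - 64 * y) * N)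
      ≤ ENNReal.ofReal (c * (2 * k - 1) * N - (M : ℝ) ^ 3 * (c * k ^ 2)) :=
        ENNReal.ofReal_le_ofReal hreal
    _ = ENNReal.ofReal (c * (2 * k - 1) * N) - ENNReal.ofReal ((M : ℝ) ^ 3 * (c * k ^ 2)) :=
        ENNReal.ofReal_sub _ (mul_nonneg (by positivity) (mul_nonneg hc0 (sq_nonneg k)))
    _ ≤ neumannGroundStateEnergy v N L + ENNReal.ofReal ((M : ℝ) ^ 3 * (c * k ^ 2)) -
          ENNReal.ofReal ((M : ℝ) ^ 3 * (c * k ^ 2)) := tsub_le_tsub_right hbig _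
    _ = neumannGroundStateEnergy v N L := ENNReal.add_sub_cancel_right ENNReal.ofReal_ne_top

/-- **LSSY Theorem 2.4, Dirichlet form, from the layers of its proof**: `LSSY2005_boxLowerBound`
(2.54), `LSSY2005_cellDecomposition` (2.52) and `LSSY2005_superadditivity` (2.53) imply the
vendored `LSSY2005_lowerBound_dirichlet` (via the Neumann statement and `E₀^Neu ≤ E₀^Dir`).
[cite: LSSY2005, Thm. 2.4 (2.35)] -/
theorem LSSY2005_lowerBound_dirichlet_of_parts (hB : LSSY2005_boxLowerBound)
    (hC : LSSY2005_cellDecomposition) (hE : LSSY2005_superadditivity) :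
    LSSY2005_lowerBound_dirichlet :=
  LSSY2005_lowerBound_dirichlet_of_neumann (LSSY2005_lowerBound_neumann_of_parts hB hC hE)

/-- **LSSY Theorem 2.4, periodic form, from the layers of its proof.** [cite: LSSY2005, Thm. 2.4 (2.35)] -/
theorem LSSY2005_lowerBound_periodic_of_parts (hB : LSSY2005_boxLowerBound)
    (hC : LSSY2005_cellDecomposition) (hE : LSSY2005_superadditivity) :
    LSSY2005_lowerBound_periodic :=
  LSSY2005_lowerBound_periodic_of_neumann (LSSY2005_lowerBound_neumann_of_parts hB hC hE)

end Literature.MathematicalPhysics.QuantumManyBody.BoseGas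

end
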